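import Summits.KontsevichZagierPeriods.KontsevichZagierPeriods.Theorems.IsogenyCertificatesXMapKernelQuasiEngineAux

/-!
# `XMapKernel` (stmt-KontsevichZagierPeriods-10663), line `derived-datum-quasi-periods` — engine core (pointwise DD and the one-datum transfer)

Second helper file of the quasi-period ENGINE (lead prover's stub `stub_quasiTransferEngine`):

* the POINTWISE form of the derived datum identity DD: with `A₀ = |c|b₀ + b₁α/|c|`, `A₁ = b₁β/|c|` and
  the certificate `u = −(2b₁/|c|)·g′`, one has
  `|c|(b₀ + b₁R(y)) − (A₀ + A₁y) = (2P(u′g − ug′) + P′ug)/(2g²)` at every real `y` with `g(y) ≠ 0`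
  (`dd_pointwise`) — the weight of the pulled-back quasi-period form splits into the egg family plus the
  Hermite form of `d(S√P)`, `S = u/g`;
* `engine_core`: the one-datum ENGINE with explicit coefficients — for an egg-regular coprime datum
  between three-real-root cubics, `[egg, ((|c|b₀ + b₁α/|c|)/m + (b₁β/(|c|m))x)/√P] ∼ [egg′, (b₀ + b₁X)/√Q]`
  for all `b₀, b₁ ∈ ℚ`, `m ≥ 1` the number of cells of the egg (inputs: the weighted cell move and the
  rational Hermite move, as hypotheses).

References: N. D. Elkies (1998), §3; M. Kontsevich, D. Zagier, *Periods* (2001), §1.2.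
-/

noncomputable section

open Set Filter MeasureTheory Polynomial Topology
open scoped BigOperators
open Literature.NumberTheory.Transcendental
open Literature.ModelTheory.ExponentialFields (IsSemialgebraic)
open Summit.KontsevichZagierPeriods.IsogenyCertificates.XMapPeriodTransferCells

namespace Summit.KontsevichZagierPeriods.IsogenyCertificates.XMapKernelStubs.QuasiEngine

/-! ### The pointwise derived datum identity -/

/-- **DD, pointwise.** If `c²fg + 2P(gg″ − g′²) + P′gg′ = (α + βX)g²` in `ℚ[X]`, then at every real
`y` with `g(y) ≠ 0`, for all `b₀, b₁ ∈ ℚ`, with `A₀ = |c|b₀ + b₁α/|c|`, `A₁ = b₁β/|c|` and the certificate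
`u = C(−2b₁/|c|)·g′`:
`|c|(b₀ + b₁ f(y)/g(y)) − (A₀ + A₁y) = (2P(y)(u′(y)g(y) − u(y)g′(y)) + P′(y)u(y)g(y))/(2g(y)²)`.
[cite: Kohel1996, §2.4] -/
theorem dd_pointwise : ∀ (A B : ℤ), ∀ (f g : Polynomial ℚ), ∀ (c α β : ℚ), (c ≠ 0) → (Polynomial.C (c ^ 2) * f * g + Polynomial.C 2 * (Polynomial.X ^ 3 + Polynomial.C (A : ℚ) * Polynomial.X + Polynomial.C (B : ℚ)) * (g * Polynomial.derivative (Polynomial.derivative g) - Polynomial.derivative g ^ 2) + Polynomial.derivative (Polynomial.X ^ 3 + Polynomial.C (A : ℚ) * Polynomial.X + Polynomial.C (B : ℚ)) * g * Polynomial.derivative g = (Polynomial.C α + Polynomial.C β * Polynomial.X) * g ^ 2) → ∀ (b₀ b₁ : ℚ), ∀ (y : ℝ), (Polynomial.aeval y g ≠ 0) → |(c : ℝ)| * ((b₀ : ℝ) + (b₁ : ℝ) * (Polynomial.aeval y f / Polynomial.aeval y g)) - ((((|c| * b₀ + b₁ * α / |c| : ℚ)) : ℝ) + ((b₁ * β /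 |c| : ℚ) : ℝ) * y) = (2 * (y ^ 3 + (A : ℝ) * y + (B : ℝ)) * (Polynomial.aeval y (Polynomial.derivative (Polynomial.C (-2 * b₁ / |c|) * Polynomial.derivative g)) * Polynomial.aeval y g - Polynomial.aeval y (Polynomial.C (-2 * b₁ / |c|) * Polynomial.derivative g) * Polynomial.aeval y (Polynomial.derivative g)) + (3 * y ^ 2 + (A : ℝ)) * Polynomial.aeval y (Polynomial.C (-2 * b₁ / |c|) * Polynomial.derivative g) * Polynomial.aeval y g) / (2 * (Polynomial.aeval y g) ^ 2) := by
  intro A B f g c α β hc hDD b₀ b₁ y hg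
  have E1 := congrArg (fun q : ℚ[X] => aeval y q) hDD
  simp only [map_add, map_mul, map_sub, map_pow, aeval_C, aeval_X, derivative_mul,
    derivative_X_pow, derivative_C, derivative_X, eq_ratCast, Rat.cast_intCast,
    zero_mul, mul_one, zero_add, add_zero, Nat.cast_ofNat, map_ofNat] at E1
  norm_num at E1
  simp only [derivative_mul, derivative_C, zero_mul, zero_add, map_mul, aeval_C, eq_ratCast]
  have hc' : (|(c : ℝ)|) ≠ 0 := abs_ne_zero.mpr (by exact_mod_cast hc)
  have hc2 : (c : ℝ) ^ 2 = |(c : ℝ)| ^ 2 := (sq_abs _).symm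
  push_cast
  set F : ℝ := aeval y f with hF
  set G : ℝ := aeval y g with hG
  set G1 : ℝ := aeval y (derivative g) with hG1
  set G2 : ℝ := aeval y (derivative (derivative g)) with hG2
  rw [hc2] at E1
  have key : 2 * (y ^ 3 + (A : ℝ) * y + (B : ℝ)) * (G * G2 - G1 ^ 2) + (3 * y ^ 2 + (A : ℝ)) * G * G1 =
      ((α : ℝ) + (β : ℝ) * y) * G ^ 2 - |(c : ℝ)| ^ 2 * F * G := by linarith
  calc |(c : ℝ)| * ((b₀ : ℝ) + (b₁ : ℝ) * (F / G)) -
        (|(c : ℝ)| * (b₀ : ℝ) + (b₁ : ℝ) * (α : ℝ) / |(c : ℝ)| + (b₁ : ℝ) * (β : ℝ) / |(c : ℝ)| * y)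
      = (-2 * (b₁ : ℝ) / |(c : ℝ)|) * (((α : ℝ) + (β : ℝ) * y) * G ^ 2 - |(c : ℝ)| ^ 2 * F * G) /
          (2 * G ^ 2) := by
        field_simp
        ring
    _ = (-2 * (b₁ : ℝ) / |(c : ℝ)|) *
          (2 * (y ^ 3 + (A : ℝ) * y + (B : ℝ)) * (G * G2 - G1 ^ 2) + (3 * y ^ 2 + (A : ℝ)) * G * G1) /
          (2 * G ^ 2) := by rw [key]
    _ = _ := by ring

/-! ### The engine for one datum (core statement, explicit coefficients) -/

/-- **The ENGINE, core form.** For an egg-regular COPRIME x-rational isogeny datum `(f, g, c)` between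
three-real-root integral cubics, with `(α, β)` from DD, there is `m ≥ 1` (the number of cells of the
source egg) such that for all `b₀, b₁ ∈ ℚ` the representations
`[egg, ((|c|b₀ + b₁α/|c|)/m + (b₁β/(|c|m))·x)/√P]` and `[egg′, (b₀ + b₁X)/√Q]` are KZ-equivalent.
Inputs (hypotheses): the weighted cell move (rule 2 per cell) and the rational Hermite move (rule 3).
Chain: domain additivity over the cells of the egg; one rule-(2) move per cell onto the WHOLE target egg
(the image of a cell is a whole component of `{Q > 0}` by the sibling `stub_cellImageComponent`, and it is
bounded because `g ≠ 0` on the closed egg); rule (1b) with the pointwise DD; the Hermite move; merging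
`m` copies; integer division. [cite: KontsevichZagier2001, §1.2] -/
theorem engine_core
    (hMove : ∀ (A B A' B' : ℤ) (f g : ℚ[X]) (c : ℚ),
      derivative f * g - f * derivative g ≠ 0 →
      C (c ^ 2) * g * (f ^ 3 + C (A' : ℚ) * f * g ^ 2 + C (B' : ℚ) * g ^ 3) =
        (X ^ 3 + C (A : ℚ) * X + C (B : ℚ)) * (derivative f * g - f * derivative g) ^ 2 →
      ∀ (R W : ℝ → ℝ) (L : Set ℝ), R = (fun y => aeval y f / aeval y g) →
        W = (fun y => aeval y (derivative f * g - f * derivative g)) →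
        L = {y : ℝ | 0 < y ^ 3 + (A : ℝ) * y + (B : ℝ) ∧ W y ≠ 0} →
      ∀ x₀ ∈ L, InjOn R (connectedComponentIn L x₀) → (∀ y ∈ connectedComponentIn L x₀, aeval y g ≠ 0) →
        ∀ (b₀ b₁ : ℚ) (rI t : KZ.IntegralRep 1),
          rI.domain = {x | x 0 ∈ connectedComponentIn L x₀} →
          EqOn rI.integrand (fun x => |(c : ℝ)| * ((b₀ : ℝ) + (b₁ : ℝ) * R (x 0)) /
            Real.sqrt (x 0 ^ 3 + (A : ℝ) * x 0 + (B : ℝ))) rI.domain →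
          t.domain = {x | x 0 ∈ R '' connectedComponentIn L x₀} →
          EqOn t.integrand (fun x => ((b₀ : ℝ) + (b₁ : ℝ) * x 0) /
            Real.sqrt (x 0 ^ 3 + (A' : ℝ) * x 0 + (B' : ℝ))) t.domain →
          KZ.of rI - KZ.of t ∈ KZ.relations)
    (hHermite : ∀ (A B : ℤ) (u g : ℚ[X]), 4 * A ^ 3 + 27 * B ^ 2 < 0 →
      ∀ (E : Set ℝ), E = {y : ℝ | 0 < y ^ 3 + (A : ℝ) * y + (B : ℝ)} \
        connectedComponentIn {y : ℝ | 0 < y ^ 3 + (A : ℝ) * y + (B : ℝ)} (1 + |(A : ℝ)| + |(B : ℝ)|) →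
      (∀ y ∈ closure E, aeval y g ≠ 0) →
      ∀ r : KZ.IntegralRep 1, r.domain = {x | x 0 ∈ E} →
        EqOn r.integrand (fun x =>
          (2 * (x 0 ^ 3 + (A : ℝ) * x 0 + (B : ℝ)) *
              (aeval (x 0) (derivative u) * aeval (x 0) g - aeval (x 0) u * aeval (x 0) (derivative g)) +
            (3 * x 0 ^ 2 + (A : ℝ)) * aeval (x 0) u * aeval (x 0) g) /
          (2 * (aeval (x 0) g) ^ 2 * Real.sqrt (x 0 ^ 3 + (A : ℝ) * x 0 + (B : ℝ)))) r.domain →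
        KZ.of r ∈ KZ.relations)
    (A B A' B' : ℤ) (hΔ : 4 * A ^ 3 + 27 * B ^ 2 < 0) (hΔ' : 4 * A' ^ 3 + 27 * B' ^ 2 < 0)
    (f g : ℚ[X]) (c : ℚ) (hcop : IsCoprime f g) (hW : derivative f * g - f * derivative g ≠ 0)
    (hI : C (c ^ 2) * g * (f ^ 3 + C (A' : ℚ) * f * g ^ 2 + C (B' : ℚ) * g ^ 3) =
      (X ^ 3 + C (A : ℚ) * X + C (B : ℚ)) * (derivative f * g - f * derivative g) ^ 2)
    (hreg : ∀ y ∈ closure ({y : ℝ | 0 < y ^ 3 + (A : ℝ) * y + (B : ℝ)} \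
      connectedComponentIn {y : ℝ | 0 < y ^ 3 + (A : ℝ) * y + (B : ℝ)} (1 + |(A : ℝ)| + |(B : ℝ)|)),
      aeval y g ≠ 0)
    (α β : ℚ)
    (hDD : C (c ^ 2) * f * g + C 2 * (X ^ 3 + C (A : ℚ) * X + C (B : ℚ)) *
        (g * derivative (derivative g) - derivative g ^ 2) +
      derivative (X ^ 3 + C (A : ℚ) * X + C (B : ℚ)) * g * derivative g = (C α + C β * X) * g ^ 2) :
    ∃ m : ℕ, 0 < m ∧ ∀ (b₀ b₁ : ℚ) (r r' : KZ.IntegralRep 1),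
      r.domain = {x | x 0 ∈ {y : ℝ | 0 < y ^ 3 + (A : ℝ) * y + (B : ℝ)} \
        connectedComponentIn {y : ℝ | 0 < y ^ 3 + (A : ℝ) * y + (B : ℝ)} (1 + |(A : ℝ)| + |(B : ℝ)|)} →
      EqOn r.integrand (fun x => (((((|c|) * b₀ + b₁ * α / (|c|)) / m : ℚ) : ℝ) +
          (((b₁ * β / (|c|)) / m : ℚ) : ℝ) * x 0) / Real.sqrt (x 0 ^ 3 + (A : ℝ) * x 0 + (B : ℝ))) r.domain →
      r'.domain = {x | x 0 ∈ {y : ℝ | 0 < y ^ 3 + (A' : ℝ) * y + (B' : ℝ)} \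
        connectedComponentIn {y : ℝ | 0 < y ^ 3 + (A' : ℝ) * y + (B' : ℝ)} (1 + |(A' : ℝ)| + |(B' : ℝ)|)} →
      EqOn r'.integrand (fun x => ((b₀ : ℝ) + (b₁ : ℝ) * x 0) /
        Real.sqrt (x 0 ^ 3 + (A' : ℝ) * x 0 + (B' : ℝ))) r'.domain →
      KZ.Equivalent r r' := by
  classical
  -- names
  set S : Set ℝ := {y : ℝ | 0 < y ^ 3 + (A : ℝ) * y + (B : ℝ)} with hS
  set U : Set ℝ := connectedComponentIn S (1 + |(A : ℝ)| + |(B : ℝ)|) with hU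
  set E : Set ℝ := S \ U with hE
  set S' : Set ℝ := {y : ℝ | 0 < y ^ 3 + (A' : ℝ) * y + (B' : ℝ)} with hS'
  set U' : Set ℝ := connectedComponentIn S' (1 + |(A' : ℝ)| + |(B' : ℝ)|) with hU'
  set E' : Set ℝ := S' \ U' with hE'
  set R : ℝ → ℝ := fun y => aeval y f / aeval y g with hR
  set W : ℝ → ℝ := fun y => aeval y (derivative f * g - f * derivative g) with hWd
  set L : Set ℝ := {y : ℝ | 0 < y ^ 3 + (A : ℝ) * y + (B : ℝ) ∧ W y ≠ 0} with hL
  have hL' : L = {y : ℝ | 0 < y ^ 3 + (A : ℝ) * y + (B : ℝ) ∧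
      aeval y (derivative f * g - f * derivative g) ≠ 0} := by rw [hL]
  obtain ⟨-, hc⟩ := XMapPeriodTransferDatum.g_ne_zero_and_c_ne_zero hW hI
  -- geometry of the source egg
  obtain ⟨e₃, e₂, e₁, h32, h21, hfac, hegg⟩ := egg_geometry A B hΔ
  have hEI : E = Ioo e₃ e₂ := hegg
  have hclos : closure E = Icc e₃ e₂ := by rw [hEI]; exact closure_Ioo h32.ne
  have hgI : ∀ y ∈ Icc e₃ e₂, aeval y g ≠ 0 := fun y hy => hreg y (by rw [hclos]; exact hy)
  have hgE : ∀ y ∈ E, aeval y g ≠ 0 := fun y hy => hreg y (subset_closure hy)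
  -- the cells of the egg
  obtain ⟨𝒞, h𝒞, hm⟩ := exists_eggCells A B hΔ f g hW
  refine ⟨𝒞.card, hm, fun b₀ b₁ r r' hr hri hr' hr'i => ?_⟩
  have hm0 : (𝒞.card : ℚ) ≠ 0 := by exact_mod_cast hm.ne'
  -- coefficients
  set A₀ : ℚ := |c| * b₀ + b₁ * α / |c| with hA₀
  set A₁ : ℚ := b₁ * β / |c| with hA₁
  -- (1) the source weighted representation `ρ = [Ê, |c|(b₀ + b₁R)/√P]`, built as `p/g /√P`
  set p : ℚ[X] := C (|c| * b₀) * g + C (|c| * b₁) * f with hp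
  have hDsa := isSemialgebraic_hat_egg A B
  have hw_sa : IsSemialgebraicFunOn ℚ {x : Fin 1 → ℝ | x 0 ∈ E}
      (fun x => aeval (x 0) p / aeval (x 0) g) :=
    isSemialgebraicFunOn_quot p g hDsa fun x hx => hgE _ hx
  have hw_cont : ContinuousOn (fun x : Fin 1 → ℝ => aeval (x 0) p / aeval (x 0) g) {x | x 0 ∈ E} :=
    (continuousOn_quot p g hgE).comp (continuous_apply 0).continuousOn fun x hx => hx
  obtain ⟨M, hM⟩ := exists_bound_quot p g hgI
  obtain ⟨ρ, hρd, hρi⟩ := exists_weightedEggRep A B hΔ _ hw_sa hw_cont M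
    (fun x hx => by
      rw [Real.norm_eq_abs]
      exact hM (x 0) (by have h : x 0 ∈ E := hx; rw [hEI] at h; exact Ioo_subset_Icc_self h))
  have hpw : ∀ y, aeval y g ≠ 0 → aeval y p / aeval y g =
      |(c : ℝ)| * ((b₀ : ℝ) + (b₁ : ℝ) * R y) := by
    intro y hy
    simp only [hp, hR, map_add, map_mul, aeval_C, eq_ratCast]
    push_cast
    field_simp
  -- (2) domain additivity over the cells
  have hspec : ∀ i : ↥𝒞, ∃ y ∈ L, y ∈ E ∧ (i : Set ℝ) = connectedComponentIn L y := fun i =>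
    (h𝒞 _).mp i.2
  have hLsa : IsSemialgebraic ℚ {x : Fin 1 → ℝ | x 0 ∈ L} := by
    rw [hL']; exact isSemialgebraic_hat_cellLocus A B f g
  have hsa : ∀ i : ↥𝒞, IsSemialgebraic ℚ {x : Fin 1 → ℝ | x 0 ∈ (i : Set ℝ)} := fun i => by
    obtain ⟨y, -, -, h⟩ := hspec i
    rw [h]; exact isSemialgebraic_hat_connectedComponentIn hLsa y
  have hsubE : ∀ i : ↥𝒞, (i : Set ℝ) ⊆ E := fun i => by
    obtain ⟨y, hyL, hyE, h⟩ := hspec i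
    rw [h]
    have hyL' := hyL
    rw [hL'] at hyL'
    have := cell_subset_egg A B f g hyL' hyE
    rw [← hL'] at this
    exact this
  have hsub : ∀ i : ↥𝒞, {x : Fin 1 → ℝ | x 0 ∈ (i : Set ℝ)} ⊆ ρ.domain := fun i x hx => by
    rw [hρd]; exact hsubE i hx
  obtain ⟨ρ_, hρ_d, hρ_i⟩ : ∃ ρ_ : ↥𝒞 → KZ.IntegralRep 1,
      (∀ i, (ρ_ i).domain = {x : Fin 1 → ℝ | x 0 ∈ (i : Set ℝ)}) ∧ ∀ i, (ρ_ i).integrand = ρ.integrand :=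
    ⟨fun i => ρ.restrict _ (hsa i) (hsub i), fun _ => rfl, fun _ => rfl⟩
  have hZfin : {y : ℝ | W y = 0}.Finite := by
    refine ((derivative f * g - f * derivative g).aroots ℝ).toFinset.finite_toSet.subset fun y hy => ?_
    have hy' : aeval y (derivative f * g - f * derivative g) = 0 := by simpa [hWd] using hy
    exact Finset.mem_coe.mpr (Multiset.mem_toFinset.mpr (Polynomial.mem_aroots.mpr ⟨hW, hy'⟩))
  have hcover : ρ.domain \ (⋃ i ∈ 𝒞.attach, (ρ_ i).domain) ⊆ {x : Fin 1 → ℝ | x 0 ∈ {y : ℝ | W y = 0}} := by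
    rintro x ⟨hxE, hxU⟩
    rw [hρd] at hxE
    by_contra hWx
    have hxL : x 0 ∈ L := by rw [hL]; exact ⟨hxE.1, hWx⟩
    have hmem : connectedComponentIn L (x 0) ∈ 𝒞 := (h𝒞 _).mpr ⟨x 0, hxL, hxE, rfl⟩
    exact hxU (Set.mem_iUnion₂.mpr ⟨⟨_, hmem⟩, Finset.mem_attach _ _, by
      rw [hρ_d]; exact mem_connectedComponentIn hxL⟩)
  have hdisj : ∀ i j : ↥𝒞, i ≠ j → (ρ_ i).domain ∩ (ρ_ j).domain = ∅ := by
    intro i j hij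
    obtain ⟨y, -, -, hi⟩ := hspec i
    obtain ⟨y', -, -, hj⟩ := hspec j
    refine Set.eq_empty_of_forall_notMem fun x hx => hij (Subtype.ext ?_)
    rw [hρ_d, hρ_d] at hx
    have hx1 : x 0 ∈ connectedComponentIn L y := by rw [← hi]; exact hx.1
    have hx2 : x 0 ∈ connectedComponentIn L y' := by rw [← hj]; exact hx.2
    rw [hi, hj, connectedComponentIn_eq hx1, connectedComponentIn_eq hx2]
  have h1 : KZ.of ρ - ∑ i ∈ 𝒞.attach, KZ.of (ρ_ i) ∈ KZ.relations := by
    refine KZ.of_sub_sum_of_mem_relations 𝒞.attach ρ ρ_ (fun i _ => ?_) (fun i _ x _ => by rw [hρ_i]) ?_ ?_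
    · rw [hρ_d, Set.sdiff_eq_empty.mpr (hsub i), measure_empty]
    · exact measure_mono_null hcover (volume_hat_eq_zero_of_finite hZfin)
    · intro i _ j _ hij
      rw [hdisj i j hij, measure_empty]
  -- (3) each cell is moved onto the whole target egg: `[ρ_ i] − [r'] ∈ relations`
  have himgE : ∀ i : ↥𝒞, InjOn R (i : Set ℝ) ∧ R '' (i : Set ℝ) = E' := by
    intro i
    obtain ⟨y, hyL, hyE, hC⟩ := hspec i
    obtain ⟨hinj, hUE⟩ := stub_cellImageComponent A B A' B' f g c hΔ'.ne hW hI hcop R W L hR hWd hL'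
      U' E' hU' hE' y hyL
    rw [hC]
    refine ⟨hinj, ?_⟩
    rcases hUE with hUimg | ⟨hEimg, -⟩
    · -- the image cannot be the unbounded component: `R` is bounded on the closed egg
      exfalso
      have hcell : connectedComponentIn L y ⊆ E := by have := hsubE i; rwa [hC] at this
      -- `R` is bounded above on the cell by `M'`
      obtain ⟨M', hM'⟩ : ∃ M' : ℝ, ∀ z ∈ connectedComponentIn L y, R z ≤ M' := by
        obtain ⟨Mf, hMf⟩ := exists_bound_quot f g hgI
        refine ⟨Mf, fun z hz => ?_⟩
        have hzI : z ∈ Icc e₃ e₂ := by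
          have hzE := hcell hz; rw [hEI] at hzE; exact Ioo_subset_Icc_self hzE
        exact (le_abs_self _).trans (hMf z hzI)
      -- but `U'` contains arbitrarily large reals
      have hbig : max M' 0 + 1 + (1 + |(A' : ℝ)| + |(B' : ℝ)|) ∈ U' := by
        rw [hU']
        exact Ici_large_subset_unbounded A' B' (by
          simp only [mem_Ici]; linarith [le_max_right M' 0])
      rw [← hUimg] at hbig
      obtain ⟨z, hz, hzR⟩ := hbig
      have := hM' z hz
      rw [hzR] at this
      linarith [le_max_left M' 0, abs_nonneg (A' : ℝ), abs_nonneg (B' : ℝ)]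
    · exact hEimg
  have h2 : ∑ i ∈ 𝒞.attach, KZ.of (ρ_ i) - ∑ i ∈ 𝒞.attach, KZ.of r' ∈ KZ.relations := by
    refine KZ.sum_sub_sum_mem_relations _ _ _ fun i _ => ?_
    obtain ⟨y, hyL, hyE, hC⟩ := hspec i
    obtain ⟨hinj, himg⟩ := himgE i
    rw [hC] at hinj himg
    refine hMove A B A' B' f g c hW hI R W L hR hWd hL' y hyL hinj
      (fun z hz => hgE z (by have := hsubE i; rw [hC] at this; exact this hz)) b₀ b₁ (ρ_ i) r'
      (by rw [hρ_d, hC]) (fun x hx => ?_) (by rw [hr', himg]) hr'i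
    rw [hρ_i, hρi]
    have hxE : x 0 ∈ E := by
      rw [hρ_d] at hx
      exact hsubE i hx
    simp only
    rw [hpw (x 0) (hgE _ hxE)]
  have hsum : ∑ i ∈ 𝒞.attach, KZ.of r' = 𝒞.card • KZ.of r' := by
    rw [Finset.sum_const, Finset.card_attach]
  -- (4) DD split on the source egg: `[ρ] − [ρ₁] − [ρ₂] ∈ relations`, `[ρ₂] ∈ relations`
  obtain ⟨T, hT⟩ : ∃ T : ℚ → ℚ → KZ.IntegralRep 1, ∀ a₀ a₁,
      (T a₀ a₁).domain = {x | x 0 ∈ E} ∧ (T a₀ a₁).integrand = fun x =>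
        ((a₀ : ℝ) + (a₁ : ℝ) * x 0) / Real.sqrt (x 0 ^ 3 + (A : ℝ) * x 0 + (B : ℝ)) :=
    ⟨fun a₀ a₁ => (exists_eggRep A B a₀ a₁ hΔ).choose, fun a₀ a₁ => (exists_eggRep A B a₀ a₁ hΔ).choose_spec⟩
  have hTd : ∀ a₀ a₁, (T a₀ a₁).domain = {x | x 0 ∈ E} := fun a₀ a₁ => (hT a₀ a₁).1
  have hTi : ∀ a₀ a₁, (T a₀ a₁).integrand = fun x =>
      ((a₀ : ℝ) + (a₁ : ℝ) * x 0) / Real.sqrt (x 0 ^ 3 + (A : ℝ) * x 0 + (B : ℝ)) := fun a₀ a₁ => (hT a₀ a₁).2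
  -- `ρ₂ = [Ê, (w − (A₀ + A₁x))/√P]`
  have hw2_sa : IsSemialgebraicFunOn ℚ {x : Fin 1 → ℝ | x 0 ∈ E}
      (fun x => aeval (x 0) p / aeval (x 0) g - ((A₀ : ℝ) + (A₁ : ℝ) * x 0)) := by
    set q : MvPolynomial (Fin 1) ℚ := MvPolynomial.C A₀ + MvPolynomial.C A₁ * MvPolynomial.X 0 with hq
    have hlin : IsSemialgebraicFunOn ℚ {x : Fin 1 → ℝ | x 0 ∈ E} (fun x : Fin 1 → ℝ => (A₀ : ℝ) + (A₁ : ℝ) * x 0) :=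
      (isSemialgebraicFunOn_aeval hDsa q).congr fun x _ => by simp [hq]
    exact IsSemialgebraicFunOn.sub_holds hw_sa hlin
  have hw2_cont : ContinuousOn (fun x : Fin 1 → ℝ => aeval (x 0) p / aeval (x 0) g - ((A₀ : ℝ) + (A₁ : ℝ) * x 0))
      {x | x 0 ∈ E} :=
    hw_cont.sub (by fun_prop : Continuous fun x : Fin 1 → ℝ => (A₀ : ℝ) + (A₁ : ℝ) * x 0).continuousOn
  obtain ⟨ρ₂, hρ₂d, hρ₂i⟩ := exists_weightedEggRep A B hΔ _ hw2_sa hw2_cont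
    (M + (|(A₀ : ℝ)| + |(A₁ : ℝ)| * (|e₃| + |e₂|)))
    (fun x hx => by
      have hxE : x 0 ∈ E := hx
      have hxI : x 0 ∈ Icc e₃ e₂ := by rw [hEI] at hxE; exact Ioo_subset_Icc_self hxE
      have hb : |x 0| ≤ |e₃| + |e₂| := by
        rcases le_or_gt 0 (x 0) with h | h
        · rw [abs_of_nonneg h]; linarith [hxI.2, le_abs_self e₂, abs_nonneg e₃]
        · rw [abs_of_neg h]; linarith [hxI.1, neg_abs_le e₃, abs_nonneg e₂]
      calc ‖aeval (x 0) p / aeval (x 0) g - ((A₀ : ℝ) + (A₁ : ℝ) * x 0)‖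
          ≤ |aeval (x 0) p / aeval (x 0) g| + |(A₀ : ℝ) + (A₁ : ℝ) * x 0| := by
            rw [Real.norm_eq_abs]; exact abs_sub _ _
        _ ≤ M + (|(A₀ : ℝ)| + |(A₁ : ℝ)| * |x 0|) := by
            gcongr
            · exact hM _ hxI
            · calc |(A₀ : ℝ) + (A₁ : ℝ) * x 0| ≤ |(A₀ : ℝ)| + |(A₁ : ℝ) * x 0| := abs_add_le _ _
                _ = |(A₀ : ℝ)| + |(A₁ : ℝ)| * |x 0| := by rw [abs_mul]
        _ ≤ M + (|(A₀ : ℝ)| + |(A₁ : ℝ)| * (|e₃| + |e₂|)) := by gcongr)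
  have h3 : KZ.of ρ - KZ.of (T A₀ A₁) - KZ.of ρ₂ ∈ KZ.relations := by
    refine KZ.integrandAddRel_subset_relations ⟨1, ρ, T A₀ A₁, ρ₂, by rw [hTd, hρd], by rw [hρ₂d, hρd],
      fun x _ => ?_, rfl⟩
    simp only [hρi, hTi, hρ₂i, Pi.add_apply]
    ring
  have h4 : KZ.of ρ₂ ∈ KZ.relations := by
    refine hHermite A B (C (-2 * b₁ / |c|) * derivative g) g hΔ E hE hreg ρ₂ hρ₂d fun x hx => ?_
    rw [hρ₂i]
    have hxE : x 0 ∈ E := by rw [hρ₂d] at hx; exact hx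
    have hgx := hgE _ hxE
    have hPx : 0 < x 0 ^ 3 + (A : ℝ) * x 0 + (B : ℝ) := by
      have : x 0 ∈ S := by rw [hE] at hxE; exact hxE.1
      exact this
    have hsq : Real.sqrt (x 0 ^ 3 + (A : ℝ) * x 0 + (B : ℝ)) ≠ 0 := (Real.sqrt_pos.mpr hPx).ne'
    simp only
    rw [hpw (x 0) hgx, hR]
    simp only
    rw [hA₀, hA₁, dd_pointwise A B f g c α β hc hDD b₀ b₁ (x 0) hgx]
    field_simp
  -- (5) merging `m` copies of `[T a₀ a₁]`, `a = A/m`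
  set a₀ : ℚ := A₀ / 𝒞.card with ha₀
  set a₁ : ℚ := A₁ / 𝒞.card with ha₁
  have h5 := merge_eggFamily T hTd hTi a₀ a₁ 𝒞.card
  have hma₀ : (𝒞.card : ℚ) * a₀ = A₀ := by rw [ha₀]; field_simp
  have hma₁ : (𝒞.card : ℚ) * a₁ = A₁ := by rw [ha₁]; field_simp
  rw [hma₀, hma₁] at h5
  -- (6) `[r] ≡ [T a₀ a₁]`
  have h6 : KZ.of r - KZ.of (T a₀ a₁) ∈ KZ.relations := by
    refine XMapPeriodTransferValue.equivalent_of_eqOn r (T a₀ a₁) (by rw [hTd, hr]) fun x hx => ?_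
    rw [hri hx, hTi]
  -- (7) assemble: `m • ([r] − [r']) ∈ relations`
  have key : 𝒞.card • (KZ.of r - KZ.of r') =
      𝒞.card • (KZ.of r - KZ.of (T a₀ a₁)) + (𝒞.card • KZ.of (T a₀ a₁) - KZ.of (T A₀ A₁)) -
        (KZ.of ρ - KZ.of (T A₀ A₁) - KZ.of ρ₂) - KZ.of ρ₂ + (KZ.of ρ - ∑ i ∈ 𝒞.attach, KZ.of (ρ_ i)) +
          (∑ i ∈ 𝒞.attach, KZ.of (ρ_ i) - ∑ i ∈ 𝒞.attach, KZ.of r') := by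
    rw [hsum]; module
  have hall : 𝒞.card • (KZ.of r - KZ.of r') ∈ KZ.relations := by
    rw [key]
    refine KZ.relations.add_mem (KZ.relations.add_mem (KZ.relations.sub_mem (KZ.relations.sub_mem
      (KZ.relations.add_mem (AddSubgroup.nsmul_mem _ h6 _) h5) h3) h4) h1) h2
  exact mem_relations_of_nsmul_mem_relations hm hall


end Summit.KontsevichZagierPeriods.IsogenyCertificates.XMapKernelStubs.QuasiEngine

end
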